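import Mathlib
import HarnessLib
import Summits.NavierStokesRegularity.NavierStokesRegularity.Theorems.HalfSpaceWindowDoorCirculationCarryingRigidityQuietBarrier
import Summits.NavierStokesRegularity.NavierStokesRegularity.Theorems.HalfSpaceWindowDoorCirculationCarryingRigidityParabolicConfinement
import Summits.NavierStokesRegularity.NavierStokesRegularity.Theorems.HalfSpaceWindowDoorCirculationCarryingRigidityRotate

/-!
# Route `HalfSpaceWindowDoor`, crux `CirculationCarryingRigidity` (stmt-NavierStokesRegularity-25311) — line `eddy_covariance`, QUIET form
# (scale-invariant): W6 = `HemisphereLiouvilleE3` ⟸ the eddy bound on record far circles that are QUIET and GROWING, BY NAME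

LEAD ns-hsw-p1 g10, `--supports 25311 --as helper`; card `Cruxes/…/Lines/eddy_covariance.md`.  From the mixed-barrier comparison
`…QuietBarrier.circ_le_of_quiet_aux`: `circ_le_sSup_of_quiet` — the sweeping conclusion `Γ(r,z,s) ≤ sup{Γ(R₁√(−s'),z',s') : s' ≤ s₁}` for ALL
`r` (`R₁ = 4(B+C) + R₀ + 1 + 8πC/η₀`) — hence parabolic confinement and POLOIDALITY (`inner_curl_e3_eq_zero_of_quietEddyBound`, via
`…ParabolicConfinement.inner_curl_e3_eq_zero_of_confined`) from the EDDY BOUND `ℛ(r,z,t) ≤ (B/√(−t))(∮ω₃ dl + |∮ω_r dl|)` required ONLY at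
times `t ≤ σ₀`, on RECORD far circles about one axis that are QUIET — `(−t)∮_{S(r,z)}ω₃ dl ≤ η₀ r` AND `(−t)|∮_{S(r,z)}ω_r dl| ≤ η₀ r` for an
arbitrarily small DIMENSIONLESS `η₀ > 0` (mean vertical and mean radial vorticity on the circle at most `η₀/(2π)` times the self-similar scale
`1/(−t)`; scale-invariant, uniform over the whole epoch, unlike the dimensionful threshold of `…FlatLiouville`) — and GROWING (`∂ₜΓ(r,z,t) > 0`).
By name: `hemisphereLiouvilleE3_of_quietEddyBound`, `circulationCarryingRigidity_of_quietEddyBound`; enemy form `enemy_quiet_fails`.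
WHAT THIS IS NOT: not about NS regularity (Clay A); HYPOTHETICAL blow-up profiles; the item stays OPEN at its research stub; nothing is closed here.
-/

noncomputable section

-- the summit and its single sub-problem share the name (CONVENTIONS §1), as in every Theorems file
set_option linter.dupNamespace false

namespace Summit.NavierStokesRegularity.NavierStokesRegularity.Theorems.HalfSpaceWindowDoorCirculationCarryingRigidityQuietLiouville

open MeasureTheory Set Function Filter Topology InnerProductSpace
open scoped RealInnerProductSpace InnerProductSpace
open Literature.Analysis Literature.Analysis.UnboundedOperators
open Literature.Analysis.FluidPDE hiding eR
open Summit.NavierStokesRegularity.NavierStokesRegularity.Theses.HalfSpaceWindowDoor (CirculationCarryingRigidity)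
open Summit.NavierStokesRegularity.NavierStokesRegularity.Theorems.HalfSpaceWindowDoorCirculationCarryingRigidityDefs
  (InDoorClass SignE3 e3 HemisphereLiouvilleE3)
open Summit.NavierStokesRegularity.NavierStokesRegularity.Theorems.AxisTwistDoorAveragedConeLiouvilleDefs
  (cylPt eR circ vortCirc radVortCirc circleTerm meanR meanZ remainder)
open Summit.NavierStokesRegularity.NavierStokesRegularity.Theorems.HalfSpaceWindowDoorCirculationCarryingRigidityConeFluxSubsolution
  (tube_bddAbove)
open Summit.NavierStokesRegularity.NavierStokesRegularity.Theorems.HalfSpaceWindowDoorCirculationCarryingRigidityQuietBarrier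
  (circ_le_of_quiet_aux)
open Summit.NavierStokesRegularity.NavierStokesRegularity.Theorems.HalfSpaceWindowDoorCirculationCarryingRigidityParabolicConfinement
  (inner_curl_e3_eq_zero_of_confined)
open Summit.NavierStokesRegularity.NavierStokesRegularity.Theorems.HalfSpaceWindowDoorCirculationCarryingRigidityRotate (stub_rotate)

variable {C : ℝ} {v : ℝ → EuclideanSpace ℝ (Fin 3) → EuclideanSpace ℝ (Fin 3)}

/-! ### Step 2: the sweeping lemma from the eddy bound -/

/-- **THE SWEEPING LEMMA, quiet form**: `Γ(r,z,s) ≤ sup { Γ(R₁√(−s'), z', s') : s' ≤ s₁ }` for all `r ≥ 0`, `s ≤ s₁ < 0`,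
`R₁ = 4(B+C) + R₀ + 1 + 8πC/η₀`, from the EDDY bound on RECORD far circles that are QUIET and GROWING, at times `≤ s₁` only
(the barrier terms `2πC r ((−s)(−s₀))^{−1/4} + (η₀/8) r²/(√(−s)√(−s₀))` vanish as `s₀ → −∞`). -/
theorem circ_le_sSup_of_quiet (hv : InDoorClass C v) (hsign : SignE3 v) {B : ℝ} (hB0 : 0 ≤ B)
    {R₀ : ℝ} (hR₀ : 0 ≤ R₀) {s₁ : ℝ} (hs₁ : s₁ < 0) {η₀ : ℝ} (hη : 0 < η₀)
    (hed : ∀ t : ℝ, t ≤ s₁ → ∀ r : ℝ, R₀ * Real.sqrt (-t) ≤ r → ∀ z : ℝ,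
      (∀ s' : ℝ, s' ≤ t → ∀ z' : ℝ,
        circ v ((4 * (B + C) + R₀ + 1 + 8 * Real.pi * C / η₀) * Real.sqrt (-s')) z' s' < circ v r z t) →
      (-t) * vortCirc v r z t ≤ η₀ * r → (-t) * |radVortCirc v r z t| ≤ η₀ * r →
      0 < deriv (fun σ => circ v r z σ) t →
      remainder v r z t ≤ B / Real.sqrt (-t) * (vortCirc v r z t + |radVortCirc v r z t|))
    {s : ℝ} (hs : s ≤ s₁) {r : ℝ} (hr : 0 ≤ r) (z : ℝ) :
    circ v r z s ≤ sSup {m : ℝ | ∃ s' : ℝ, s' ≤ s₁ ∧ ∃ z' : ℝ, m = circ v ((4 * (B + C) + R₀ + 1 + 8 * Real.pi * C / η₀) * Real.sqrt (-s')) z' s'} := by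
  set μ := sSup {m : ℝ | ∃ s' : ℝ, s' ≤ s₁ ∧ ∃ z' : ℝ, m = circ v ((4 * (B + C) + R₀ + 1 + 8 * Real.pi * C / η₀) * Real.sqrt (-s')) z' s'}
  have hC : 0 ≤ C := HalfSpaceWindowDoorCirculationCarryingRigidityConeFluxSubsolution.typeI_const_nonneg hv
  have hs0 : s < 0 := lt_of_le_of_lt hs hs₁
  have hsqs : 0 < Real.sqrt (-s) := Real.sqrt_pos.2 (neg_pos.2 hs0)
  refine le_of_forall_pos_le_add fun δ hδ => ?_
  -- `s₀` so negative that both barrier terms at time `s` are `≤ δ/2`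
  set L : ℝ := η₀ / 8 * r ^ 2 / (Real.sqrt (-s) * (δ / 2)) with hL
  have hL0 : 0 ≤ L := by positivity
  set M : ℝ := (2 * Real.pi * C * r / (δ / 2)) ^ 2 / Real.sqrt (-s) with hM
  have hM0 : 0 ≤ M := by positivity
  set s₀ : ℝ := s - 1 - L ^ 2 - M ^ 2 with hs₀def
  have hs₀s : s₀ < s := by rw [hs₀def]; nlinarith [sq_nonneg L, sq_nonneg M]
  have hs₀₁ : s₀ < s₁ := lt_of_lt_of_le hs₀s hs
  have hsq₀ : L ≤ Real.sqrt (-s₀) := by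
    rw [show L = Real.sqrt (L ^ 2) from (Real.sqrt_sq hL0).symm]
    exact Real.sqrt_le_sqrt (by rw [hs₀def]; nlinarith [sq_nonneg M])
  have hsq₀M : M ≤ Real.sqrt (-s₀) := by
    rw [show M = Real.sqrt (M ^ 2) from (Real.sqrt_sq hM0).symm]
    exact Real.sqrt_le_sqrt (by rw [hs₀def]; nlinarith [sq_nonneg L])
  have hsq₀pos : 0 < Real.sqrt (-s₀) := Real.sqrt_pos.2 (by linarith)
  have h := circ_le_of_quiet_aux hv hsign hB0 hR₀ hs₀₁ hs₁ hη hed s ⟨hs₀s.le, hs⟩ r hr z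
  -- quadratic term `≤ δ/2`
  have hquad : η₀ / 8 * r ^ 2 / (Real.sqrt (-s) * Real.sqrt (-s₀)) ≤ δ / 2 := by
    rw [div_le_iff₀ (by positivity)]
    have h1 : η₀ / 8 * r ^ 2 = L * (Real.sqrt (-s) * (δ / 2)) := by rw [hL]; field_simp
    rw [h1]
    have := mul_le_mul_of_nonneg_left hsq₀ (by positivity : 0 ≤ Real.sqrt (-s) * (δ / 2))
    nlinarith [this]
  -- linear term `≤ δ/2`: `2πC r/√(√(−s)√(−s₀)) ≤ δ/2` iff `(2πCr/(δ/2))² ≤ √(−s)√(−s₀)`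
  have hlin : 2 * Real.pi * C * (Real.sqrt (Real.sqrt (-s) * Real.sqrt (-s₀)))⁻¹ * r ≤ δ / 2 := by
    have hg : 0 < Real.sqrt (-s) * Real.sqrt (-s₀) := mul_pos hsqs hsq₀pos
    have hG : 0 < Real.sqrt (Real.sqrt (-s) * Real.sqrt (-s₀)) := Real.sqrt_pos.2 hg
    have hM' : (2 * Real.pi * C * r / (δ / 2)) ^ 2 ≤ Real.sqrt (-s) * Real.sqrt (-s₀) := by
      have e : (2 * Real.pi * C * r / (δ / 2)) ^ 2 = M * Real.sqrt (-s) := by rw [hM]; field_simp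
      rw [e, mul_comm]
      exact mul_le_mul_of_nonneg_left hsq₀M hsqs.le
    have hroot : 2 * Real.pi * C * r / (δ / 2) ≤ Real.sqrt (Real.sqrt (-s) * Real.sqrt (-s₀)) := by
      rw [← Real.sqrt_sq (by positivity : 0 ≤ 2 * Real.pi * C * r / (δ / 2))]
      exact Real.sqrt_le_sqrt hM'
    have h2 : 2 * Real.pi * C * r ≤ δ / 2 * Real.sqrt (Real.sqrt (-s) * Real.sqrt (-s₀)) := by
      rw [div_le_iff₀ (by positivity)] at hroot
      linarith
    have e : 2 * Real.pi * C * (Real.sqrt (Real.sqrt (-s) * Real.sqrt (-s₀)))⁻¹ * r =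
        (2 * Real.pi * C * r) / Real.sqrt (Real.sqrt (-s) * Real.sqrt (-s₀)) := by
      field_simp
    rw [e, div_le_iff₀ hG]
    exact h2
  linarith

/-! ### Step 4: W6 and the crux from the eddy bound -/

/-- **W6 ⟸ THE EDDY BOUND ON RECORD FAR CIRCLES (time-only class, any `C`).**  Door class + `⟪curl v, e₃⟫ ≥ 0`; fix `B, R₀ ≥ 0`,
`R₁ = 4(B+C) + R₀ + 1 + 8πC/η₀`, `η₀ > 0` and an epoch `σ₀ < 0`; if the eddy remainder obeys
`ℛ(r,z,t) ≤ (B/√(−t))(∮_{S(r,z)}ω₃ dl + |∮_{S(r,z)}ω_r dl|)` for `t ≤ σ₀` on the record far circles about the `e₃`-axis that are QUIET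
(`(−t)∮ω₃ dl ≤ η₀ r`, `(−t)|∮ω_r dl| ≤ η₀ r`) and GROWING (`∂ₜΓ > 0`), then `⟪curl v, e₃⟫ ≡ 0` on the whole slab.  Proof: the eddy sweeping lemma
at `s₁ = σ₀` is parabolic confinement with `S₀ = sup{Γ(R₁√(−s'),z',s') : s' ≤ σ₀}`; apply `inner_curl_e3_eq_zero_of_confined`. -/
theorem inner_curl_e3_eq_zero_of_quietEddyBound (hv : InDoorClass C v) (hsign : SignE3 v) {B : ℝ} (hB : 0 ≤ B)
    {R₀ : ℝ} (hR₀ : 0 ≤ R₀) {σ₀ : ℝ} (hσ₀ : σ₀ < 0) {η₀ : ℝ} (hη : 0 < η₀)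
    (hed : ∀ t : ℝ, t ≤ σ₀ → ∀ r : ℝ, R₀ * Real.sqrt (-t) ≤ r → ∀ z : ℝ,
      (∀ s' : ℝ, s' ≤ t → ∀ z' : ℝ,
        circ v ((4 * (B + C) + R₀ + 1 + 8 * Real.pi * C / η₀) * Real.sqrt (-s')) z' s' < circ v r z t) →
      (-t) * vortCirc v r z t ≤ η₀ * r → (-t) * |radVortCirc v r z t| ≤ η₀ * r →
      0 < deriv (fun σ => circ v r z σ) t →
      remainder v r z t ≤ B / Real.sqrt (-t) * (vortCirc v r z t + |radVortCirc v r z t|)) :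
    ∀ s < 0, ∀ y, ⟪curl (v s) y, e3⟫ = 0 := by
  have hC : 0 ≤ C := HalfSpaceWindowDoorCirculationCarryingRigidityConeFluxSubsolution.typeI_const_nonneg hv
  set R₁ : ℝ := 4 * (B + C) + R₀ + 1 + 8 * Real.pi * C / η₀ with hR₁
  have hR₁0 : 0 ≤ R₁ := by positivity
  set S : Set ℝ := {m : ℝ | ∃ s' : ℝ, s' ≤ σ₀ ∧ ∃ z' : ℝ, m = circ v (R₁ * Real.sqrt (-s')) z' s'} with hS
  set S₀ : ℝ := sSup S with hS₀
  obtain ⟨hSbdd, -⟩ := tube_bddAbove hv hR₁0 hσ₀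
  have hSne : S.Nonempty := ⟨_, σ₀, le_rfl, 0, rfl⟩
  refine inner_curl_e3_eq_zero_of_confined hv hsign hR₁0 hσ₀ (S₀ := S₀) ?_ ?_
  · intro s hs r hr z
    exact circ_le_sSup_of_quiet hv hsign hB hR₀ hσ₀ hη hed hs hr z
  · intro ε hε
    have hlt : S₀ - ε < S₀ := by linarith
    obtain ⟨m, ⟨s', hs', z', rfl⟩, hm⟩ := exists_lt_of_lt_csSup hSne hlt
    exact ⟨s', hs', z', hm⟩

/-- **ENEMY FORM (census reading).**  A circulation-carrying closed-hemisphere door-class profile violates the eddy bound: for all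
`B, R₀ ≥ 0` and every epoch `σ₀ < 0` there are a time `t ≤ σ₀` and a RECORD far circle `S(r,z)` (`r ≥ R₀√(−t)`, carrying more
circulation than every tube-boundary disc `D(R₁√(−s'),z')`, `s' ≤ t`) with `ℛ(r,z,t) > (B/√(−t))(∮ω₃ dl + |∮ω_r dl|)`. -/
theorem enemy_quiet_fails (hv : InDoorClass C v) (hsign : SignE3 v) (hpos : ∃ σ < 0, ∃ y, 0 < ⟪curl (v σ) y, e3⟫)
    {B : ℝ} (hB : 0 ≤ B) {R₀ : ℝ} (hR₀ : 0 ≤ R₀) {σ₀ : ℝ} (hσ₀ : σ₀ < 0) {η₀ : ℝ} (hη : 0 < η₀) :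
    ∃ t : ℝ, t ≤ σ₀ ∧ ∃ r : ℝ, R₀ * Real.sqrt (-t) ≤ r ∧ ∃ z : ℝ,
      (∀ s' : ℝ, s' ≤ t → ∀ z' : ℝ,
        circ v ((4 * (B + C) + R₀ + 1 + 8 * Real.pi * C / η₀) * Real.sqrt (-s')) z' s' < circ v r z t) ∧
      (-t) * vortCirc v r z t ≤ η₀ * r ∧ (-t) * |radVortCirc v r z t| ≤ η₀ * r ∧
      0 < deriv (fun σ => circ v r z σ) t ∧
      B / Real.sqrt (-t) * (vortCirc v r z t + |radVortCirc v r z t|) < remainder v r z t := by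
  by_contra h
  push Not at h
  obtain ⟨σ, hσ, y, hy⟩ := hpos
  have h0 := inner_curl_e3_eq_zero_of_quietEddyBound hv hsign hB hR₀ hσ₀ hη
    (fun t ht r hr z hrec h1 h2 h3 => h t ht r hr z hrec h1 h2 h3) σ hσ y
  exact hy.ne' h0

/-- **Crux format.**  In the situation of the crux specialised to `e = e₃` (closed hemisphere, circulation-carrying), the eddy bound on the
record circles of one far-past epoch is contradictory — in particular the apex is not backward-singular. -/
theorem not_isBackwardSingularPoint_of_quietEddyBound (hv : InDoorClass C v) (hsign : SignE3 v)
    (hpos : ∃ σ < 0, ∃ y, 0 < ⟪curl (v σ) y, e3⟫) {B : ℝ} (hB : 0 ≤ B) {R₀ : ℝ} (hR₀ : 0 ≤ R₀) {σ₀ : ℝ} (hσ₀ : σ₀ < 0)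
    {η₀ : ℝ} (hη : 0 < η₀)
    (hed : ∀ t : ℝ, t ≤ σ₀ → ∀ r : ℝ, R₀ * Real.sqrt (-t) ≤ r → ∀ z : ℝ,
      (∀ s' : ℝ, s' ≤ t → ∀ z' : ℝ,
        circ v ((4 * (B + C) + R₀ + 1 + 8 * Real.pi * C / η₀) * Real.sqrt (-s')) z' s' < circ v r z t) →
      (-t) * vortCirc v r z t ≤ η₀ * r → (-t) * |radVortCirc v r z t| ≤ η₀ * r →
      0 < deriv (fun σ => circ v r z σ) t →
      remainder v r z t ≤ B / Real.sqrt (-t) * (vortCirc v r z t + |radVortCirc v r z t|)) :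
    ¬ IsBackwardSingularPoint v 0 := by
  intro _
  obtain ⟨t, ht, r, hr, z, hrec, h1, h2, h3, hlt⟩ := enemy_quiet_fails hv hsign hpos hB hR₀ hσ₀ hη
  exact (not_lt.2 (hed t ht r hr z hrec h1 h2 h3)) hlt

/-- **BY-NAME REDUCTION of the open stub W6.**  If every closed-hemisphere profile of the door class obeys, for SOME `B, R₀ ≥ 0` and SOME
epoch `σ₀ < 0`, the eddy bound on the record far circles about the `e₃`-axis at the times `≤ σ₀`, then `HemisphereLiouvilleE3` holds. -/
theorem hemisphereLiouvilleE3_of_quietEddyBound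
    (H : ∀ (C : ℝ) (v : ℝ → EuclideanSpace ℝ (Fin 3) → EuclideanSpace ℝ (Fin 3)), InDoorClass C v → SignE3 v →
      ∃ B : ℝ, 0 ≤ B ∧ ∃ R₀ : ℝ, 0 ≤ R₀ ∧ ∃ σ₀ : ℝ, σ₀ < 0 ∧ ∃ η₀ : ℝ, 0 < η₀ ∧
        ∀ t : ℝ, t ≤ σ₀ → ∀ r : ℝ, R₀ * Real.sqrt (-t) ≤ r → ∀ z : ℝ,
          (∀ s' : ℝ, s' ≤ t → ∀ z' : ℝ,
            circ v ((4 * (B + C) + R₀ + 1 + 8 * Real.pi * C / η₀) * Real.sqrt (-s')) z' s' < circ v r z t) →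
          (-t) * vortCirc v r z t ≤ η₀ * r → (-t) * |radVortCirc v r z t| ≤ η₀ * r →
          0 < deriv (fun σ => circ v r z σ) t →
          remainder v r z t ≤ B / Real.sqrt (-t) * (vortCirc v r z t + |radVortCirc v r z t|)) :
    HemisphereLiouvilleE3 := by
  intro C v hrate hcont hmild hdiv hnn
  have hv : InDoorClass C v := ⟨hrate, hcont, hmild, hdiv⟩
  obtain ⟨B, hB, R₀, hR₀, σ₀, hσ₀, η₀, hη, hed⟩ := H C v hv hnn
  exact inner_curl_e3_eq_zero_of_quietEddyBound hv hnn hB hR₀ hσ₀ hη hed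

/-- **The CRUX from the eddy bound** (every direction `e ≠ 0`: rotation covariance `stub_rotate` ∘ `hemisphereLiouvilleE3_of_quietEddyBound`). -/
theorem circulationCarryingRigidity_of_quietEddyBound
    (H : ∀ (C : ℝ) (v : ℝ → EuclideanSpace ℝ (Fin 3) → EuclideanSpace ℝ (Fin 3)), InDoorClass C v → SignE3 v →
      ∃ B : ℝ, 0 ≤ B ∧ ∃ R₀ : ℝ, 0 ≤ R₀ ∧ ∃ σ₀ : ℝ, σ₀ < 0 ∧ ∃ η₀ : ℝ, 0 < η₀ ∧
        ∀ t : ℝ, t ≤ σ₀ → ∀ r : ℝ, R₀ * Real.sqrt (-t) ≤ r → ∀ z : ℝ,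
          (∀ s' : ℝ, s' ≤ t → ∀ z' : ℝ,
            circ v ((4 * (B + C) + R₀ + 1 + 8 * Real.pi * C / η₀) * Real.sqrt (-s')) z' s' < circ v r z t) →
          (-t) * vortCirc v r z t ≤ η₀ * r → (-t) * |radVortCirc v r z t| ≤ η₀ * r →
          0 < deriv (fun σ => circ v r z σ) t →
          remainder v r z t ≤ B / Real.sqrt (-t) * (vortCirc v r z t + |radVortCirc v r z t|)) :
    CirculationCarryingRigidity :=
  stub_rotate (hemisphereLiouvilleE3_of_quietEddyBound H)

end Summit.NavierStokesRegularity.NavierStokesRegularity.Theorems.HalfSpaceWindowDoorCirculationCarryingRigidityQuietLiouville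

end
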